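import Summits.ABC.IUTFork.Cor312NaiveProvShells
import Summits.ABC.IUTFork.Cor312NaiveThm311
import Summits.ABC.IUTFork.Cor312GapWitnessProvenance
import HarnessLib

/-!
# The naive model over ANY index skeleton, II: the typed [IUTchIII] Theorem 3.11 holds, contentfully

Record-only file (D-0012) of the abc-iut cell (D-0067 adjudication, ADJUDICATION-SPEC v2.1 §2 (G3) / §4 (iii);
support piece «G-NV-PROV», seat abc-iut-w4-d026); TAKES NO SIDE.  Part II of three.  abc-iut-w5-d247's
`NaiveWitness.naiveFull_statement` (`Cor312NaiveThm311`) proves c312-1's typed Thm. 3.11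
(`Thm311.FullSituation.Statement`) on CONTENTFUL data over the one-place index `toyIndex`; this file does the same
over an ARBITRARY index skeleton `T` (in particular over abc-iut-c312-5's `Thm311.Real.thetaIndexOfInitial D` of a
genuine initial Θ-datum `D`), with a volume SCALE `c` and ONE supported place `v_ℚ⁰` (this seat's A-4′ recipe,
`Cor312GapWitnessProvenance`):
* (i)(a) `data`: integral structures the unit cylinders `B_0` (PROPER), admissible regions the cylinders,
  log-volume `μ(B_k) = −k·c` at `v_ℚ⁰` and `0` at every other place (so global sums are finite); (i)(b) splitting
  monoids `Psi v = {(±θ_{v,j})_{j ∈ 𝔽_l^⋇}}` at EVERY bad place `v`, `θ_{v,j}` the pure tensor supported on the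
  summand `v` with entries `q^{j²}`, `q := p` — NONZERO (`zero_notMem_Psi`) and inside the SUB-packets
  (`thetaVec_mem_subPacket`, a genuine support condition when the fibre `{w | v_ℚ}` has several points);
  (i)(c) `degrees`: objects `p^k𝒪`, `k ∈ ℤ`, degree `−k·c` = the global log-volume of the region `B_k`;
* (ii) `column`: Frobenius-like data at `(n,m)` = the coric data transported by the TWIST `(−1)^m ∈ Ism`
  (w5-d247's `twist`, here `negFamily` over `T`, a moving non-identity family at odd `m`): KummerA ⟸ the twist
  fixes cylinders, KummerB ⟸ `Ψ_v` is sign-saturated and `negFamily` is the scalar `(−1)^{j+1}` on the packet at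
  label `j`, KummerC ⟸ the twist is onto; (Ind3) BOTH clauses — nonarchimedean AND archimedean (the index of a
  genuine `D` has an archimedean place): unit-group images `B_{m'+1} ⊊ B_0`, arch ball images `B_0`;
  Frobenioid objects on distinct carriers (w5-d247's `FrobObj`/`kum`);
* (iii) w5-d247's `naiveLink` (one-object groupoid of `ℤˣ`, `κ_{n,m} = (−1)^m`, non-identity automorphisms).
HONEST SCOPE: a model of the typed signatures over the index skeleton, not of the intended objects; volumes are
supported at ONE place; (i)'s multiradial compatibility holds because all vertical lines carry the same data
(bi-coric strictification).  No judgement on print; no `Prop` fact; standard axioms.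
[claim: Mochizuki2012, status: disputed] [cite: ScholzeStix2018, §2.2 pp. 9–10]
-/

noncomputable section

namespace Summit.ABC

namespace IUTFork

namespace Cor312Vol

namespace NaiveProv

open Thm311 Cor312 Cor312.IdentifiedNonVacuity Literature.IUT.LogThetaLattice

variable {T : ThetaIndex} (p : ℕ) (vQ₀ : T.VQ) (c : ℝ)

/-! ## 5. The one-place log-volume -/

open scoped Classical in
/-- The LOG-VOLUME of the model: the scaled cylinder volume `μ(B_k) = −k·c` at the supported place `v_ℚ⁰`, `0` at
every other place (all but finitely many local volumes vanish, [IUTchIII] Prop. 3.9 (iii)). [claim: Mochizuki2012, status: disputed] -/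
def vol (j : T.Label) (vQ : T.VQ) (A : Set ((signShells T).Packet j vQ)) : ℝ :=
  if vQ = vQ₀ then ballVol p c j vQ A else 0

/-- At `v_ℚ⁰` the log-volume is the scaled cylinder volume. [folklore] -/
theorem vol_self (j : T.Label) (A : Set ((signShells T).Packet j vQ₀)) : vol p vQ₀ c j vQ₀ A = ballVol p c j vQ₀ A := by
  simp [vol]

/-- Away from `v_ℚ⁰` every region has log-volume `0`. [folklore] -/
theorem vol_of_ne {j : T.Label} {vQ : T.VQ} (h : vQ ≠ vQ₀) (A : Set ((signShells T).Packet j vQ)) :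
    vol p vQ₀ c j vQ A = 0 := by
  simp [vol, h]

/-- `μ(B_k) = −k·c` at `v_ℚ⁰`. [folklore] -/
theorem vol_self_pBall [hp : Fact p.Prime] (j : T.Label) (k : ℤ) :
    vol p vQ₀ c j vQ₀ (pBall p j vQ₀ k) = -(k : ℝ) * c := by
  rw [vol_self, ballVol_pBall]

/-- The log-volume is monotone on cylinders at every place (`0 ≤ c`). [folklore] -/
theorem vol_mono [hp : Fact p.Prime] (hc : 0 ≤ c) {j : T.Label} {vQ : T.VQ} {k k' : ℤ}
    (h : pBall p j vQ k ⊆ pBall p j vQ k') : vol p vQ₀ c j vQ (pBall p j vQ k) ≤ vol p vQ₀ c j vQ (pBall p j vQ k') := by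
  by_cases hv : vQ = vQ₀
  · subst hv; rw [vol_self, vol_self]; exact ballVol_mono p c hc h
  · rw [vol_of_ne p vQ₀ c hv, vol_of_ne p vQ₀ c hv]

/-- The `finsum` over the places of `μ(B_k)` is `−k·c` (one term, at `v_ℚ⁰`). [folklore] -/
theorem finsum_vol_pBall [hp : Fact p.Prime] (j : T.Label) (k : ℤ) :
    (∑ᶠ vQ : T.VQ, vol p vQ₀ c j vQ (pBall p j vQ k)) = -(k : ℝ) * c := by
  rw [finsum_eq_single _ vQ₀ fun vQ hvQ => vol_of_ne p vQ₀ c hvQ _]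
  exact vol_self_pBall p vQ₀ c j k

/-! ## 6. The theta vectors and the splitting monoids at the bad places -/

/-- The exponent `j²` of the theta value `q^{j²}` at label `j`. [claim: Mochizuki2012, status: disputed] -/
def jsq (j : T.Label) : ℤ := (((j : ℕ) ^ 2 : ℕ) : ℤ)

open scoped Classical in
/-- The THETA VECTOR at the bad place `v`, label `j`: the pure tensor all of whose factors are supported on the
summand `v` of `⊕_{w | v_ℚ(v)} ℚ` with entry `q^{j²}`, `q := p` (the theta value `q_v^{j²}` of [IUTchIII] Prop. 3.5
(ii) (c) placed in the sub-packet at `v`). [claim: Mochizuki2012, status: disputed] -/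
def thetaVec (v : T.V) (j : T.Label) : (signShells T).Packet j (T.over v) :=
  PiTensorProduct.tprod ℚ fun (_ : T.Caps j) (w : T.Fibre (T.over v)) =>
    if w = T.toFibre v then (p : ℚ) ^ ((j : ℕ) ^ 2) else 0

/-- The theta vector lies in the SUB-packet `𝓘^ℚ(^{S^±_{j+1},j};𝒟^⊢_v)` (its `j`-th factor — indeed every factor —
is supported on the summand `v`). [folklore] -/
theorem thetaVec_mem_subPacket (v : T.V) (j : T.Label) : thetaVec p v j ∈ (signShells T).SubPacket j v := by
  refine Submodule.subset_span ⟨_, fun w hw => ?_, rfl⟩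
  have hne : w ≠ T.toFibre v := fun h => hw (by rw [h]; rfl)
  simp [hne]

/-- The coordinate AT `v` of the theta vector is `q^{(j+1)·j²} ≠ 0`: **the theta vector is NONZERO**. [folklore] -/
theorem thetaVec_ne_zero [hp : Fact p.Prime] (v : T.V) (j : T.Label) : thetaVec p v j ≠ 0 := by
  intro h
  have h1 := congrArg (coordAt j (T.over v) (T.toFibre v)) h
  unfold thetaVec at h1
  rw [coordAt_tprod, map_zero] at h1
  simp only [if_true, Finset.prod_const] at h1
  exact pow_ne_zero _ (pow_ne_zero _ (Nat.cast_ne_zero.mpr hp.out.ne_zero)) h1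

/-- The SPLITTING MONOID at the bad place `v`: the sign-translates `(±θ_{v,j})_{j ∈ 𝔽_l^⋇}` of the tuple of theta
vectors ([IUTchIII] Thm. 3.11 (i) (b); Prop. 3.5 (ii) (c): torsion-translates of the theta values).
[claim: Mochizuki2012, status: disputed] -/
def Psi (v : T.V) : Set ((signShells T).StarPacket v) :=
  {f | ∀ j : T.LabelStar, f j = thetaVec p v j.1 ∨ f j = -thetaVec p v j.1}

/-- The tuple of theta vectors itself. [claim: Mochizuki2012, status: disputed] -/
def thetaTuple (v : T.V) : (signShells T).StarPacket v := fun j => thetaVec p v j.1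

/-- The theta tuple lies in the splitting monoid (which is therefore NONEMPTY). [folklore] -/
theorem thetaTuple_mem_Psi (v : T.V) : thetaTuple p v ∈ Psi p v := fun _ => Or.inl rfl

/-- The label `1 ∈ 𝔽_l^⋇` (`l⋇ ≥ 2`). [folklore] -/
def labelOne : T.LabelStar :=
  ⟨⟨1, Nat.lt_succ_of_le (le_trans (by decide) T.two_le_lstar)⟩, fun h => absurd (congrArg Fin.val h) (by simp)⟩

/-- `0 ∉ Ψ_v`: the splitting monoid is not the degenerate `{0}`. [folklore] -/
theorem zero_notMem_Psi [hp : Fact p.Prime] (v : T.V) : (0 : (signShells T).StarPacket v) ∉ Psi p v := by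
  intro h
  rcases h labelOne with h1 | h1
  · exact thetaVec_ne_zero p v _ (h1.symm.trans rfl)
  · exact thetaVec_ne_zero p v _ (neg_eq_zero.1 (h1.symm.trans rfl))

/-- The splitting monoid sits in the product of the sub-packets. [folklore] -/
theorem Psi_subPacket (v : T.V) {f : (signShells T).StarPacket v} (hf : f ∈ Psi p v) (j : T.LabelStar) :
    f j ∈ (signShells T).SubPacket j.1 v := by
  rcases hf j with h | h
  · rw [h]; exact thetaVec_mem_subPacket p v j.1
  · rw [h]; exact Submodule.neg_mem _ (thetaVec_mem_subPacket p v j.1)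

/-! ## 7. The Kummer twist and its action on cylinders and splitting monoids -/

/-- The (Ind2)-family "`−1` on every summand of every factor" (w4-d101's `negFamily`, index-generic). [folklore] -/
def negFamily : (signShells T).PacketAut := fun j vQ =>
  (signShells T).factorwise j vQ fun _ => (signShells T).summandwise vQ fun _ => LinearEquiv.neg ℚ

/-- … is an (Ind2)-family. [folklore] -/
theorem negFamily_mem_Ind2Family : (negFamily : (signShells T).PacketAut) ∈ (signShells T).Ind2Family :=
  fun _ _ => ⟨fun _ _ => LinearEquiv.neg ℚ, fun _ _ => Set.mem_insert_of_mem _ rfl, rfl⟩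

/-- `negFamily` is the SCALAR `(−1)^{#S^±_{j+1}}` on the packet at label `j` (multilinearity). [folklore] -/
theorem negFamily_eq_smul (j : T.Label) (vQ : T.VQ) (x : (signShells T).Packet j vQ) :
    negFamily j vQ x = (∏ _i : T.Caps j, (-1 : ℚ)) • x := by
  have h : (negFamily j vQ : (signShells T).Packet j vQ ≃ₗ[ℚ] _).toLinearMap =
      (∏ _i : T.Caps j, (-1 : ℚ)) • LinearMap.id := by
    apply PiTensorProduct.ext
    ext y
    simp only [LinearMap.compMultilinearMap_apply]
    show negFamily j vQ (PiTensorProduct.tprod ℚ y) = (∏ _i : T.Caps j, (-1 : ℚ)) • PiTensorProduct.tprod ℚ y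
    unfold negFamily LogShells.factorwise
    erw [PiTensorProduct.congr_tprod]
    have hy : (fun i => (signShells T).summandwise vQ (fun _ => LinearEquiv.neg ℚ) (y i)) =
        fun i => (-1 : ℚ) • y i := by
      funext i; rw [neg_one_smul]; rfl
    rw [hy, MultilinearMap.map_smul_univ]
  exact congrArg (fun f : (signShells T).Packet j vQ →ₗ[ℚ] (signShells T).Packet j vQ => f x) h

/-- `negFamily` MOVES the point `1 ⊗ ⋯ ⊗ 1` of the 1-capsule packet (label `0`): the (Ind1),(Ind2)-group does not
act trivially. [folklore] -/
theorem negFamily_moves (vQ : T.VQ) : negFamily 0 vQ (onePt (0 : T.Label) vQ) ≠ onePt 0 vQ := by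
  intro h
  have hprod : ∏ _i : T.Caps 0, (-1 : ℚ) = -1 := by
    show ∏ _i : Fin (0 + 1), (-1 : ℚ) = -1
    simp
  have h2 := congrArg (coord 0 vQ) h
  rw [negFamily_eq_smul, hprod, map_smul, coord_onePt, smul_eq_mul] at h2
  norm_num at h2

/-- The Kummer TWIST at lattice position `m`: the identity for even `m`, `negFamily` ("`−1` on every summand of every
factor", an (Ind2)-family that moves points) for odd `m` (w5-d247's `twist`, index-generic). [claim: Mochizuki2012, status: disputed] -/
def twist (m : ℤ) : (signShells T).PacketAut := if Even m then 1 else negFamily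

/-- The twist acts by signs. [folklore] -/
theorem twist_actsBySigns (m : ℤ) : ActsBySigns (T := T) (twist m) := by
  unfold twist
  split_ifs
  · exact actsBySigns_one
  · exact actsBySigns_of_mem_Ind2Family negFamily_mem_Ind2Family

/-- The twist fixes every cylinder. [folklore] -/
theorem image_pBall_twist (m : ℤ) (j : T.Label) (vQ : T.VQ) (k : ℤ) :
    twist m j vQ '' pBall p j vQ k = pBall p j vQ k :=
  image_pBall_of_actsBySigns p (twist_actsBySigns m) j vQ k

/-- The twist is a SCALAR `s = ±1` on every packet. [folklore] -/
theorem twist_eq_smul (m : ℤ) (j : T.Label) (vQ : T.VQ) :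
    ∃ s : ℚ, (s = 1 ∨ s = -1) ∧ ∀ x : (signShells T).Packet j vQ, twist m j vQ x = s • x := by
  unfold twist
  split_ifs
  · exact ⟨1, Or.inl rfl, fun x => by rw [one_smul]; rfl⟩
  · refine ⟨∏ _i : T.Caps j, (-1 : ℚ), ?_, negFamily_eq_smul j vQ⟩
    rw [Finset.prod_const]
    exact neg_one_pow_eq_or ℚ _

/-- Scaling by `±1` preserves "being `±θ`". [folklore] -/
theorem smul_eq_or_iff {M : Type} [AddCommGroup M] [Module ℚ M] {s : ℚ} (hs : s = 1 ∨ s = -1) (x θ : M) :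
    (s • x = θ ∨ s • x = -θ) ↔ (x = θ ∨ x = -θ) := by
  rcases hs with rfl | rfl
  · rw [one_smul]
  · rw [neg_one_smul, neg_inj, neg_eq_iff_eq_neg, or_comm]

/-- **The twist maps `Ψ_v` onto itself** (the splitting monoid is sign-saturated; not by `rfl` at odd `m`). [folklore] -/
theorem image_Psi_twist (m : ℤ) (v : T.V) : (signShells T).starAut (twist m) v '' Psi p v = Psi p v := by
  have key : ∀ f : (signShells T).StarPacket v, (signShells T).starAut (twist m) v f ∈ Psi p v ↔ f ∈ Psi p v := by
    intro f
    refine forall_congr' fun j => ?_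
    obtain ⟨s, hs, hsm⟩ := twist_eq_smul m j.1 (T.over v)
    show (twist m j.1 _ (f j) = _ ∨ twist m j.1 _ (f j) = _) ↔ _
    rw [hsm]
    exact smul_eq_or_iff hs _ _
  apply Set.Subset.antisymm
  · rintro _ ⟨f, hf, rfl⟩; exact (key f).2 hf
  · intro f hf
    exact ⟨((signShells T).starAut (twist m) v).symm f, (key _).1 (by rwa [LinearEquiv.apply_symm_apply]),
      LinearEquiv.apply_symm_apply _ _⟩

/-! ## 8. The data (a)(b)(c), the column, the full situation -/

section Model

variable [hp : Fact p.Prime]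

/-- **The data (a)(b)(c) of the model** ([IUTchIII] Thm. 3.11 (i)) over the index skeleton `T`: integral structures
the unit cylinders `B_0` (PROPER), admissible regions the cylinders, the one-place log-volume `vol`; splitting
monoids `Ψ_v` at every bad place acting by coordinatewise multiplication by the packet coordinate; number-field
copy the whole global packet. [claim: Mochizuki2012, status: disputed] -/
def data : MRData (signShells T) where
  shellPk := fun j vQ => pBall p j vQ 0
  shellSub := fun j v => pBall p j (T.over v) 0
  Adm := fun j vQ A => ∃ k, A = pBall p j vQ k
  logvol := fun j vQ A => vol p vQ₀ c j vQ A
  Ψ := fun v _ => Psi p v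
  act := fun v _ y => LinearMap.pi fun j => (coord j.1 (T.over v) (y j)) • LinearMap.proj j
  Mmod := fun _ => Set.univ

/-- **(c)'s global realified Frobenioids**: objects the fractional ideals `p^k𝒪`, `k ∈ ℤ` (both copies, identified by
the identity), degree `−k·c`, region the cylinder `B_k` at every place. [claim: Mochizuki2012, status: disputed] -/
def degrees (j : T.LabelStar) : GlobalDegrees (signShells T) j where
  ObjMOD := ℤ
  Objmod := ℤ
  natIso := Equiv.refl ℤ
  deg := fun k => -(k : ℝ) * c
  region := fun k vQ => pBall p j.1 vQ k

/-- The SITUATION: sign shells over `T`, the same data on every vertical line (bi-coric strictification).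
(An `abbrev`, so that `.L` reduces to `signShells T`.) [claim: Mochizuki2012, status: disputed] -/
abbrev situation : Situation T where
  L := signShells T
  D := fun _ => data p vQ₀ c
  G := fun _ j => degrees p c j

/-- **The column `n` of the model** ([IUTchIII] Thm. 3.11 (ii)): Frobenius-like data at `(n,m)` = the coric data
transported by the twist `(−1)^m ∈ Ism`; unit-group images at iterate `m'` the cylinders `B_{m'+1}` (shrinking),
archimedean ball images `B_0`; Frobenioid objects w5-d247's tagged copies of `ℤ` with the forgetful Kummer
bijections; Θ-pilot the object of index `1`. [claim: Mochizuki2012, status: disputed] -/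
def column : Column (signShells T) where
  frobAdm := fun m j vQ A => ∃ k, twist m j vQ '' A = pBall p j vQ k
  frobLogvol := fun m j vQ A => vol p vQ₀ c j vQ (twist m j vQ '' A)
  frobΨ := fun m v _ => (signShells T).starAut (twist m) v '' Psi p v
  frobMmod := fun m j => (signShells T).globalAut (twist m) j.1 '' Set.univ
  unitImage := fun _ m' j vQ => pBall p j vQ ((m' : ℤ) + 1)
  ballImage := fun _ j vQ => pBall p j vQ 0
  ObjLGP := ℤ
  frobObjLGP := NaiveWitness.FrobObj
  kumLGP := NaiveWitness.kum
  ObjLgp := ℤ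
  frobObjLgp := NaiveWitness.FrobObj
  kumLgp := NaiveWitness.kum
  thetaPilot := fun m => ⟨(1, m), rfl⟩

/-- **The full situation of [IUTchIII] Thm. 3.11 in the model** over `T` (an `abbrev`): the situation, the same
column everywhere, w5-d247's link data `naiveLink`. [claim: Mochizuki2012, status: disputed] -/
abbrev full : FullSituation T where
  toSituation := situation p vQ₀ c
  col := fun _ => column p vQ₀ c
  link := NaiveWitness.naiveLink

/-! ## 9. The typed Theorem 3.11 (i) ∧ (ii) ∧ (iii) holds in the model -/

/-- (i): the (nonempty, zero-free) splitting monoids sit in the sub-packets; the degree of `p^k𝒪` IS the global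
log-volume `−k·c` of its region (one supported place); the classes `^{n,∘}𝔯^{LGP}` coincide. [folklore] -/
theorem partI : (full p vQ₀ c).PartI := by
  refine ⟨fun n v hv x hx j => Psi_subPacket p v hx j, fun n j k => ⟨fun vQ => ⟨k, rfl⟩, ?_, ?_⟩, fun _ _ => rfl⟩
  · exact GapWitnessProv.support_finite_of_ne vQ₀ fun vQ hvQ => vol_of_ne p vQ₀ c hvQ _
  · exact (finsum_vol_pBall p vQ₀ c j.1 k).symm

omit hp in
/-- (ii), column by column: KummerA = the twist fixes cylinders (admissibility and log-volume read the same
cylinder), KummerB = sign-saturation of `Ψ_v`, KummerC = the twist is onto, (Ind3) nonarchimedean AND archimedean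
= `B_{m'+1} ⊆ B_0`, `B_0 ⊆ B_0`. [folklore] -/
theorem partII : (full p vQ₀ c).toLatticeSituation.PartII := by
  intro n
  refine (Column.partII_iff _ _).2 ⟨?_, fun m v hv => image_Psi_twist p m v,
    fun m j => Set.image_univ_of_surjective ((signShells T).globalAut (twist m) j.1).surjective, ?_, ?_⟩
  · rintro m j vQ A ⟨k, rfl⟩
    exact ⟨⟨k, image_pBall_twist p m j vQ k⟩, by
      show vol p vQ₀ c j vQ (twist m j vQ '' pBall p j vQ k) = vol p vQ₀ c j vQ (pBall p j vQ k)
      rw [image_pBall_twist]⟩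
  · exact fun m m' j vQ _ => pBall_mono p j vQ (by omega)
  · intro m j vQ _
    exact ⟨pBall_mono p j vQ (by norm_num), subset_rfl, fun m' _ => pBall_mono p j vQ (by omega)⟩

/-- (iii): squares of full poly-isomorphisms commute; the Kummer isomorphism `(−1)^m` is equivariant for the
`ℤˣ`-automorphisms (an abelian commutation); full permutation poly-isomorphisms are stabilized. [folklore] -/
theorem partIII : (full p vQ₀ c).PartIII := by
  refine ⟨NaiveWitness.naiveLink.partIIIa_holds, NaiveWitness.naiveLink.partIIIb_holds, ?_, ?_,
    (full p vQ₀ c).evalCompatUpToInd_of_multiradialCompat (partI p vQ₀ c).2.2⟩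
  · refine NaiveWitness.naiveLink.partIIIc_of_full (fun _ => rfl) fun n m => ?_
    rintro _ ⟨a, rfl⟩
    show NaiveWitness.unitIso a ≪≫ NaiveWitness.unitIso ((-1) ^ m.natAbs) =
      NaiveWitness.unitIso ((-1) ^ m.natAbs) ≪≫ NaiveWitness.unitIso a
    rw [NaiveWitness.unitIso_trans, NaiveWitness.unitIso_trans, mul_comm]
  · intro n m; exact Thm311.PolyIsoCalc.stabilized_full _ _

/-- **The typed Theorem 3.11 (i) ∧ (ii) ∧ (iii) HOLDS in the model**, over every index skeleton, prime, supported
place and scale. [folklore] -/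
theorem full_statement : (full p vQ₀ c).Statement := ⟨partI p vQ₀ c, partII p vQ₀ c, partIII p vQ₀ c⟩

omit hp in
/-- The (Ind1),(Ind2)-group of the situation acts NON-trivially on the packets (`negFamily` moves `1 ⊗ ⋯ ⊗ 1`).
[folklore] -/
theorem indGroup_nontrivial (vQ : T.VQ) :
    ∃ Φ ∈ Setting.indGroup (situation p vQ₀ c), ∃ (j : T.Label) (vQ : T.VQ) (x : (signShells T).Packet j vQ),
      Φ j vQ x ≠ x :=
  ⟨negFamily, Subgroup.subset_closure (Or.inr negFamily_mem_Ind2Family), 0, vQ, onePt 0 vQ, negFamily_moves vQ⟩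

/-- CONTENTFULNESS CENSUS of the Thm-3.11 instance, as kernel conjuncts: nonempty zero-free splitting monoids at
every bad place, nonempty number-field copies, proper nonempty shells with the `m' = 1` unit image strictly inside,
non-identity theater automorphisms in the link data, a non-trivially acting (Ind1),(Ind2)-group. [folklore] -/
theorem full_contentful (vQ : T.VQ) :
    (∀ (n : ℤ) (v : T.V) (hv : v ∈ T.Vbad),
        (((full p vQ₀ c).D n).Ψ v hv).Nonempty ∧ (0 : (signShells T).StarPacket v) ∉ ((full p vQ₀ c).D n).Ψ v hv) ∧
      (∀ (n : ℤ) (j : T.LabelStar), (((full p vQ₀ c).D n).Mmod j).Nonempty) ∧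
      (∀ (n : ℤ) (j : T.Label) (vQ : T.VQ),
        (((full p vQ₀ c).D n).shellPk j vQ).Nonempty ∧ ((full p vQ₀ c).D n).shellPk j vQ ≠ Set.univ ∧
          ∀ m : ℤ, ((full p vQ₀ c).col n).unitImage m 1 j vQ ⊂ ((full p vQ₀ c).D n).shellPk j vQ) ∧
      (∀ n m : ℤ, ∃ a : (full p vQ₀ c).link.AutHT n m,
        (full p vQ₀ c).link.onDelta n m a ≠ CategoryTheory.Iso.refl _) ∧
      (∃ Φ ∈ Setting.indGroup (full p vQ₀ c).toSituation,
        ∃ (j : T.Label) (vQ : T.VQ) (x : (signShells T).Packet j vQ), Φ j vQ x ≠ x) := by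
  refine ⟨fun n v hv => ⟨⟨thetaTuple p v, thetaTuple_mem_Psi p v⟩, zero_notMem_Psi p v⟩,
    fun n j => ⟨0, Set.mem_univ _⟩, fun n j vQ => ⟨⟨0, zero_mem_pBall p j vQ 0⟩, pBall_ne_univ p j vQ 0, fun m => ?_⟩,
    fun n m => ⟨(-1 : ℤˣ), NaiveWitness.unitIso_neg_one_ne_refl⟩, indGroup_nontrivial p vQ₀ c vQ⟩
  show pBall p j vQ ((1 : ℕ) + 1 : ℤ) ⊂ pBall p j vQ 0
  exact (pBall_succ_ssubset p j vQ 1).trans_subset (pBall_mono p j vQ (by norm_num))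

end Model

end NaiveProv

end Cor312Vol

end IUTFork

end Summit.ABC

end
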